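import Summits.BirchSwinnertonDyer.BirchSwinnertonDyer.Theorems.EisensteinPrimesMazurMCOnCellBKernelCertP13NoReverseEdge
import HarnessLib

/-!
# Crux 3 `MazurMCOnCellB` (stmt-BirchSwinnertonDyer-19033), line `twistback` — A REVERSE TWO-STEP EDGE NEEDS TWO FIELDS:
# the in-degree theorem of the certified double-twist graph (every `p`) and 6⁷'s doors at semistable classes
# (companion `…TwistbackReverseEdgeTwoFieldsEngine`: the two-field enumeration engine)

Width seat bsd-line-x2-p1-w6 (gen 23), cell `bsd-eis` (run/shared/lean/pub/bsd-eis/), 2026-08-30; lane (η) #9;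
`--supports stmt-BirchSwinnertonDyer-19033 --as helper`. THEOREMS ONLY (no `def`, no named fact, no `sorry`, no instance). The
registered line `twistback` v13b is NOT touched; nothing here closes a stub.

WHY / WHAT IS NEW. The zig-zag relation of the registered supply stub 6⁷ (`stub_offSubrow_connectedShaUnitOrPartner`, both disjuncts)
steps `A → B` by a FORWARD certified two-step edge `TwoStepAt p A B` (x2-p1-w6 g3, `…TwistbackTwoStepDefs`) or by a REVERSE one
`TwoStepAt p B A`. Gen 22 (`…KernelCertP13NoReverseEdge` I–V, p768810 …) priced reverse edges through the support of the edge's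
SECOND field only: `TwoStepAt p U W` with fields `K`, `K″` and middle curve `Ud` forces every prime `q ∣ d_{K″}` to satisfy
`q² ∣ N_W` (`sq_dvd_conductorNorm_of_dvd_discr`). THE CONSTRAINT ADDED HERE: the FIRST field is priced by the same lemma one twist
earlier — `K` is Heegner for `N_U` and `C • Ud = U ⊗ χ_{d_K}` with `U` globally minimal, so every prime `q ∣ d_K` has `q² ∣ N_{Ud}`;
`K″` is Heegner for `N_{Ud}`, so such a `q` SPLITS in `K″` (`q ∤ d_{K″}`: the two supports are DISJOINT), and the second twist is
unramified at `q`, so `q² ∣ N_W` as well (`factorization_conductorNorm_quadraticTwist_eq_of_not_dvd`). Net (`TwoStepAt.twoFields`):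
BOTH `d_K` and `d_{K″}` are odd fundamental discriminants `< −4` supported on odd primes `q` with `q² ∣ N_W`, with disjoint supports,
the source `U ≅ W ⊗ χ_{d_K d_{K″}}` and the middle curve `Ud ≅ W ⊗ χ_{d_{K″}}` are GOOD at their primes, and every other prime of
`N_W` divides `N_U` and `N_{Ud}` (so it splits in `K` resp. `K″`). CONSEQUENCES, class-wide and for every `p`:
* `TwoStepAt.exists_two_odd_primes_sq_dvd`: the target of an edge has TWO DISTINCT odd primes `q₁ ≠ q₂` with `qᵢ² ∣ N_W`, both
  prime to `N_U`;
* `not_twoStepAt_into_of_sq_subsingleton` / `not_twoStepAt_into_of_squarefree`: a curve with at most one odd prime of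
  non-squarefree conductor — in particular every SEMISTABLE curve — is the target of NO edge (in-degree `0` in the graph, every
  `p`, unconditionally); `…_isogenous_…` at class level granted modularity (`N_{W₁} = N_E`, Atkin–Lehner);
* `eq_or_firstStep_forward_of_not_into` (every `p`; gen 22 had `p = 13`) and the two DOOR theorems
  `leftDoor_firstStep_of_squarefree` / `rightDoor_firstStep_of_squarefree`: at a semistable isogeny class, the datum of EITHER
  disjunct of 6⁷ (token for token) is a distance-`0` datum (a Ш-unit curve in the class / a good partner AT the class) or BEGINS
  WITH A FORWARD EDGE out of the class (an analytic-rank-one reading at a twist by a field Heegner for `(N, p)`);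
* (companion file `…TwistbackReverseEdgeTwoFieldsEngine`) the TWO-FIELD ENGINE `exists_sublists_of_twoStepAt_into₂` /
  `not_twoStepAt_into_of_check₂` (every odd `p`; data form over two DISJOINT sublists `S` (support of `d_{K″}`) and `T` (support of
  `d_K`) of the odd bad primes, with the residue conditions of both Heegner hypotheses) refining gen 22's one-list engine.
ATLAS DATUM (memo `P13-TWO-FIELDS-w6g23.md`, evidence on -19033; tools/revcensus2.py, 0.06 s): of the 2627 X2b classes at `13` in
the lane's census (g19–g21), gen 22 found 36 admitting an admissible SECOND field; with the first field priced as here the number of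
classes admitting an admissible PAIR is **0 / 2627** — gen 22's successor item (f) («a reverse edge from below at 36 classes») is void.

HONEST FRAMING: elementary kernel facts about conductors of quadratic twists, fundamental discriminants and the Heegner hypothesis;
the class-level statements are CONDITIONAL on `nonempty_modularParametrizationData` (modularity, a conjunct of the doors' own cone)
for `N_{W₁} = N_E` only; nothing about any L-value, Selmer group, Ш, main conjecture or BSD is asserted; the doors of twistback 6⁷ stay
CONDITIONAL and un-instantiated; closes no registered stub; 0 cells / labels / stubs / tiers move; no summit statement, no case of
Mazur's main conjecture and no case of BSD is proved for any curve. Mirror `HOME/line-x2-p1-w6-g23/`.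
References: [GrossLMS1991] §1 (p. 235: the Heegner hypothesis — every prime of the level splits); [SilvermanAEC2009] VII.5 Prop. 5.1(c),
X.2 Prop. 2.4, X.5 Cor. 5.4, App. C §16; [SilvermanATAEC1994] IV.9.4, IV.10; [AtkinLehner1970] Thm. 4; [IrelandRosen1990] Prop. 5.1.1,
13.1.3–13.1.4; this lane's `…KernelCertP13NoReverseEdge` (p768810), `…DoorPrice` (p764408), `…DoorPriceClassI` (p766256), x2-p1-w6 g3
`…TwistbackTwoStepDefs`.
-/

set_option autoImplicit false
-- `Summit.BirchSwinnertonDyer.BirchSwinnertonDyer.…`: the summit and its single sub-problem share a name.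
set_option linter.dupNamespace false

noncomputable section

open scoped Classical
open WeierstrassCurve NumberField Literature.NumberTheory.EllipticCurves
  Literature.NumberTheory.EllipticCurves.ModularForms
  Literature.NumberTheory.QuadraticFields
  Literature.NumberTheory.EllipticCurves.Rank1Residual
  Literature.NumberTheory.EllipticCurves.Rank1Residual.Typed
  IsDedekindDomain Rat.HeightOneSpectrum
  Summit.BirchSwinnertonDyer.Rank1Residual
  Summit.BirchSwinnertonDyer.BirchSwinnertonDyer.Theorems
  Summit.BirchSwinnertonDyer.BirchSwinnertonDyer.Theorems.EisensteinPrimesMazurMCOnCellBTwistbackTwoStepDefs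
  Summit.BirchSwinnertonDyer.BirchSwinnertonDyer.Theorems.EisensteinPrimesMazurMCOnCellBKernelCertP13DoorPrice
  Summit.BirchSwinnertonDyer.BirchSwinnertonDyer.Theorems.EisensteinPrimesMazurMCOnCellBKernelCertP13DoorPriceClassI
  Summit.BirchSwinnertonDyer.BirchSwinnertonDyer.Theorems.EisensteinPrimesMazurMCOnCellBKernelCertP13NoReverseEdge

namespace Summit.BirchSwinnertonDyer.BirchSwinnertonDyer.Theorems.EisensteinPrimesMazurMCOnCellBTwistbackReverseEdgeTwoFields

/-! ## §1 Transport of conductor exponents through a twist unramified at `q`; an arithmetic triviality -/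

/-- **Conductor exponents at `q ∤ d` agree along `C • W = Wd ⊗ χ_d`** (`d ≡ 1 (mod 4)`): the exponent is invariant under the twist at
a place prime to `d` (`factorization_conductorNorm_quadraticTwist_eq_of_not_dvd`) and under isomorphism (`conductorExponent_smul'`). In
factorisation currency; both directions of gen 21's `dvd_conductorNorm_of_smul_eq_quadraticTwist`.
[cite: SilvermanATAEC1994, IV.9.4 and IV.10] [cite: SilvermanAEC2009, App. C §16] -/
theorem factorization_conductorNorm_eq_of_smul_eq_quadraticTwist {W Wd : WeierstrassCurve ℚ} [W.IsElliptic] [Wd.IsElliptic]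
    {d : ℤ} (hd4 : d % 4 = 1) {C : VariableChange ℚ} (hC : C • W = Wd.quadraticTwist (d : ℚ))
    {q : ℕ} (hq : q.Prime) (hqd : ¬ (q : ℤ) ∣ d) :
    (W.conductorNorm ℤ).factorization q = (Wd.conductorNorm ℤ).factorization q := by
  have hd0 : d ≠ 0 := by omega
  have hdq : (d : ℚ) ≠ 0 := by exact_mod_cast hd0
  haveI := Wd.isElliptic_quadraticTwist hdq
  set v : IsDedekindDomain.HeightOneSpectrum ℤ := (Rat.HeightOneSpectrum.primesEquiv (R := ℤ)).symm ⟨q, hq⟩ with hv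
  have hgen : Rat.HeightOneSpectrum.natGenerator v = q :=
    congrArg Subtype.val ((Rat.HeightOneSpectrum.primesEquiv (R := ℤ)).apply_symm_apply ⟨q, hq⟩)
  have hfW := factorization_conductorNorm_holds W v
  have hfT := factorization_conductorNorm_holds (Wd.quadraticTwist (d : ℚ)) v
  have htw := Wd.factorization_conductorNorm_quadraticTwist_eq_of_not_dvd hd4 v (by rw [hgen]; exact hqd)
  rw [hgen] at hfW hfT htw
  have hsm : (C • W).conductorExponent v = W.conductorExponent v := conductorExponent_smul' v W C
  rw [hC] at hsm
  rw [hfW, ← hsm, ← hfT, htw]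

/-- An odd integer `d < −4` has an odd prime divisor (`|d| ≥ 5` has a prime factor, which is not `2`). [folklore] -/
theorem exists_odd_prime_dvd_of_odd_of_lt {d : ℤ} (hodd : Odd d) (hlt : d < -4) :
    ∃ q : ℕ, q.Prime ∧ q ≠ 2 ∧ (q : ℤ) ∣ d := by
  have hn : d.natAbs ≠ 1 := by omega
  obtain ⟨q, hq, hqd⟩ := Nat.exists_prime_and_dvd hn
  refine ⟨q, hq, ?_, Int.natCast_dvd.mpr hqd⟩
  rintro rfl
  have h2 : (2 : ℤ) ∣ d := by exact_mod_cast (Int.natCast_dvd.mpr hqd : ((2 : ℕ) : ℤ) ∣ d)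
  rw [Int.odd_iff] at hodd
  omega

/-! ## §2 The two fields of a reverse edge -/

/-- **A REVERSE TWO-STEP EDGE NEEDS TWO FIELDS.** Unpacking `TwoStepAt p U W` (fields `K`, `K″`, middle curve `Ud`): `K` is imaginary
quadratic, Heegner for `N_U` and `p`, `d_K` odd `< −4`; `K″` likewise for `N_{Ud}` and `p`; the middle curve is a model of
`W ⊗ χ_{d_{K″}}` and the source a model of `W ⊗ χ_{d_{K″} d_K}` (twisting back, twists compose through models); and
(SECOND FIELD, gen 22) every prime `q ∣ d_{K″}` has `q² ∣ N_W`, `q ∤ N_{Ud}`, `q ∤ N_U`;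
(FIRST FIELD, new) every prime `q ∣ d_K` has `q² ∣ N_W`, `q² ∣ N_{Ud}`, `q ∤ d_{K″}` (disjoint supports) and `q ∤ N_U`;
(TRANSPORT) a prime of `N_W` not dividing `d_{K″}` divides `N_{Ud}`, and one dividing neither discriminant divides `N_U`.
Bookkeeping over `sq_dvd_conductorNorm_of_dvd_discr`, `SatisfiesHeegnerHypothesis.not_dvd_discr`,
`factorization_conductorNorm_quadraticTwist_eq_of_not_dvd`, `dvd_conductorNorm_of_smul_eq_quadraticTwist`.
[cite: GrossLMS1991, §1 (p. 235)] [cite: SilvermanAEC2009, VII.5 Prop. 5.1(c), X.5 Cor. 5.4 and App. C §16] -/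
theorem TwoStepAt.twoFields {p : ℕ} {U W : WeierstrassCurve ℚ} (h : TwoStepAt p U W) :
    ∃ (_ : U.IsElliptic) (_ : U.IsGloballyMinimal) (K : Type) (_ : Field K) (_ : NumberField K)
      (Ud : WeierstrassCurve ℚ) (_ : Ud.IsElliptic) (_ : Ud.IsGloballyMinimal) (K'' : Type) (_ : Field K'') (_ : NumberField K''),
      IsImaginaryQuadratic K ∧ SatisfiesHeegnerHypothesis (U.conductorNorm ℤ) K ∧ SatisfiesHeegnerHypothesis p K ∧
      Odd (NumberField.discr K) ∧ NumberField.discr K < -4 ∧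
      IsImaginaryQuadratic K'' ∧ SatisfiesHeegnerHypothesis (Ud.conductorNorm ℤ) K'' ∧ SatisfiesHeegnerHypothesis p K'' ∧
      Odd (NumberField.discr K'') ∧ NumberField.discr K'' < -4 ∧
      (∃ C : VariableChange ℚ, C • Ud = W.quadraticTwist (NumberField.discr K'' : ℚ)) ∧
      (∃ C : VariableChange ℚ, C • U = W.quadraticTwist ((NumberField.discr K'' * NumberField.discr K : ℤ) : ℚ)) ∧
      (∀ q : ℕ, q.Prime → (q : ℤ) ∣ NumberField.discr K'' →
        q ^ 2 ∣ W.conductorNorm ℤ ∧ ¬ q ∣ Ud.conductorNorm ℤ ∧ ¬ q ∣ U.conductorNorm ℤ) ∧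
      (∀ q : ℕ, q.Prime → (q : ℤ) ∣ NumberField.discr K →
        q ^ 2 ∣ W.conductorNorm ℤ ∧ q ^ 2 ∣ Ud.conductorNorm ℤ ∧ ¬ (q : ℤ) ∣ NumberField.discr K'' ∧ ¬ q ∣ U.conductorNorm ℤ) ∧
      (∀ q : ℕ, q.Prime → q ∣ W.conductorNorm ℤ → ¬ (q : ℤ) ∣ NumberField.discr K'' → q ∣ Ud.conductorNorm ℤ) ∧
      (∀ q : ℕ, q.Prime → q ∣ W.conductorNorm ℤ → ¬ (q : ℤ) ∣ NumberField.discr K → ¬ (q : ℤ) ∣ NumberField.discr K'' →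
        q ∣ U.conductorNorm ℤ) := by
  obtain ⟨hUE, hUM, hWE, _, K, iFK, iNK, hK, hHN, hHp, hodd, hlt, -, Ud, hUdE, hUdM, ⟨C₁, hC₁⟩, K'', iF'', iN'', hK'',
    hodd'', hlt'', hHN'', hHp'', -, ⟨C₂, hC₂⟩⟩ := h
  have hd4 : NumberField.discr K % 4 = 1 := by
    rcases Quadratic.discr_emod_four hK.1 with h0 | h1
    · exfalso; rw [Int.odd_iff] at hodd; omega
    · exact h1
  have hd4'' : NumberField.discr K'' % 4 = 1 := by
    rcases Quadratic.discr_emod_four hK''.1 with h0 | h1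
    · exfalso; rw [Int.odd_iff] at hodd''; omega
    · exact h1
  have hd0 : NumberField.discr K ≠ 0 := by omega
  have hd0'' : NumberField.discr K'' ≠ 0 := by omega
  have hdq : (NumberField.discr K : ℚ) ≠ 0 := by exact_mod_cast hd0
  have hdq'' : (NumberField.discr K'' : ℚ) ≠ 0 := by exact_mod_cast hd0''
  -- the middle curve and the source as twists of the target
  obtain ⟨C₂', hC₂'⟩ := exists_variableChange_twist_back hdq'' hC₂
  obtain ⟨C₁', hC₁'⟩ := exists_variableChange_twist_back hdq hC₁
  obtain ⟨C₃, hC₃⟩ := exists_smul_eq_quadraticTwist_mul hC₂' hC₁'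
  -- FIRST FIELD
  have hB : ∀ q : ℕ, q.Prime → (q : ℤ) ∣ NumberField.discr K →
      q ^ 2 ∣ W.conductorNorm ℤ ∧ q ^ 2 ∣ Ud.conductorNorm ℤ ∧ ¬ (q : ℤ) ∣ NumberField.discr K'' ∧
        ¬ q ∣ U.conductorNorm ℤ := by
    intro q hq hqd
    have hsqUd : q ^ 2 ∣ Ud.conductorNorm ℤ := sq_dvd_conductorNorm_of_dvd_discr hK hHN hodd hC₁ hq hqd
    have hqUd : q ∣ Ud.conductorNorm ℤ := (dvd_pow_self q two_ne_zero).trans hsqUd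
    have hqd'' : ¬ (q : ℤ) ∣ NumberField.discr K'' :=
      Literature.SatisfiesHeegnerHypothesis.not_dvd_discr hK''.1 hHN'' hq hqUd
    have hqU : ¬ q ∣ U.conductorNorm ℤ := fun hqN ↦
      Literature.SatisfiesHeegnerHypothesis.not_dvd_discr hK.1 hHN hq hqN hqd
    have hfac : (W.conductorNorm ℤ).factorization q = (Ud.conductorNorm ℤ).factorization q :=
      factorization_conductorNorm_eq_of_smul_eq_quadraticTwist hd4'' hC₂ hq hqd''
    have hle : 2 ≤ (Ud.conductorNorm ℤ).factorization q :=
      (hq.pow_dvd_iff_le_factorization (conductorNorm_pos_holds Ud).ne').mp hsqUd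
    refine ⟨(hq.pow_dvd_iff_le_factorization (conductorNorm_pos_holds W).ne').mpr ?_, hsqUd, hqd'', hqU⟩
    rw [hfac]; exact hle
  -- SECOND FIELD
  have hA : ∀ q : ℕ, q.Prime → (q : ℤ) ∣ NumberField.discr K'' →
      q ^ 2 ∣ W.conductorNorm ℤ ∧ ¬ q ∣ Ud.conductorNorm ℤ ∧ ¬ q ∣ U.conductorNorm ℤ := by
    intro q hq hqd''
    have hqUd : ¬ q ∣ Ud.conductorNorm ℤ := fun hqN ↦
      Literature.SatisfiesHeegnerHypothesis.not_dvd_discr hK''.1 hHN'' hq hqN hqd''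
    have hqd : ¬ (q : ℤ) ∣ NumberField.discr K := fun hqd ↦ (hB q hq hqd).2.2.1 hqd''
    refine ⟨sq_dvd_conductorNorm_of_dvd_discr hK'' hHN'' hodd'' hC₂ hq hqd'', hqUd, fun hqU ↦ hqUd ?_⟩
    exact dvd_conductorNorm_of_smul_eq_quadraticTwist hd4 hC₁' hq hqU hqd
  -- TRANSPORT
  have hC : ∀ q : ℕ, q.Prime → q ∣ W.conductorNorm ℤ → ¬ (q : ℤ) ∣ NumberField.discr K'' → q ∣ Ud.conductorNorm ℤ :=
    fun q hq hqW hqd'' ↦ dvd_conductorNorm_of_smul_eq_quadraticTwist hd4'' hC₂ hq hqW hqd''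
  have hD : ∀ q : ℕ, q.Prime → q ∣ W.conductorNorm ℤ → ¬ (q : ℤ) ∣ NumberField.discr K →
      ¬ (q : ℤ) ∣ NumberField.discr K'' → q ∣ U.conductorNorm ℤ :=
    fun q hq hqW hqd hqd'' ↦ dvd_conductorNorm_of_smul_eq_quadraticTwist hd4 hC₁ hq (hC q hq hqW hqd'') hqd
  exact ⟨hUE, hUM, K, iFK, iNK, Ud, hUdE, hUdM, K'', iF'', iN'', hK, hHN, hHp, hodd, hlt, hK'', hHN'', hHp'', hodd'', hlt'',
    ⟨C₂', hC₂'⟩, ⟨C₃, by rw [hC₃, Int.cast_mul]⟩, hA, hB, hC, hD⟩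

/-- **The target of an edge has TWO DISTINCT odd primes of non-squarefree conductor**, both prime to the source's conductor:
`TwoStepAt p U W ⇒ ∃ q₁ ≠ q₂` odd primes with `q₁², q₂² ∣ N_W` and `q₁, q₂ ∤ N_U` (an odd prime of `d_K` and one of `d_{K″}`;
distinct because the supports are disjoint). Every `p`; unconditional. [cite: GrossLMS1991, §1 (p. 235)] -/
theorem TwoStepAt.exists_two_odd_primes_sq_dvd {p : ℕ} {U W : WeierstrassCurve ℚ} (h : TwoStepAt p U W) :
    ∃ q₁ q₂ : ℕ, q₁.Prime ∧ q₂.Prime ∧ q₁ ≠ 2 ∧ q₂ ≠ 2 ∧ q₁ ≠ q₂ ∧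
      q₁ ^ 2 ∣ W.conductorNorm ℤ ∧ q₂ ^ 2 ∣ W.conductorNorm ℤ ∧ ¬ q₁ ∣ U.conductorNorm ℤ ∧ ¬ q₂ ∣ U.conductorNorm ℤ := by
  obtain ⟨_, _, K, _, _, Ud, _, _, K'', _, _, -, -, -, hodd, hlt, -, -, -, hodd'', hlt'', -, -, hA, hB, -, -⟩ := TwoStepAt.twoFields h
  obtain ⟨q₁, hq₁, hq₁2, hq₁d⟩ := exists_odd_prime_dvd_of_odd_of_lt hodd hlt
  obtain ⟨q₂, hq₂, hq₂2, hq₂d⟩ := exists_odd_prime_dvd_of_odd_of_lt hodd'' hlt''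
  refine ⟨q₁, q₂, hq₁, hq₂, hq₁2, hq₂2, ?_, (hB q₁ hq₁ hq₁d).1, (hA q₂ hq₂ hq₂d).1, (hB q₁ hq₁ hq₁d).2.2.2,
    (hA q₂ hq₂ hq₂d).2.2⟩
  rintro rfl
  exact (hB q₁ hq₁ hq₁d).2.2.1 hq₂d

/-! ## §3 In-degree zero: curves with at most one odd square in the conductor, semistable curves, their isogeny classes -/

/-- **IN-DEGREE ZERO.** If the odd primes `q` with `q² ∣ N_W` form a subsingleton (at most one odd prime of additive reduction),
then NO certified two-step edge ends at `W`: `∀ U, ¬ TwoStepAt p U W`, every `p`, unconditionally. [cite: GrossLMS1991, §1 (p. 235)] -/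
theorem not_twoStepAt_into_of_sq_subsingleton {W : WeierstrassCurve ℚ}
    (h1 : ∀ q₁ q₂ : ℕ, q₁.Prime → q₂.Prime → q₁ ≠ 2 → q₂ ≠ 2 →
      q₁ ^ 2 ∣ W.conductorNorm ℤ → q₂ ^ 2 ∣ W.conductorNorm ℤ → q₁ = q₂)
    (p : ℕ) (U : WeierstrassCurve ℚ) : ¬ TwoStepAt p U W := fun h ↦ by
  obtain ⟨q₁, q₂, hq₁, hq₂, h12, h22, hne, hsq₁, hsq₂, -, -⟩ := TwoStepAt.exists_two_odd_primes_sq_dvd h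
  exact hne (h1 q₁ q₂ hq₁ hq₂ h12 h22 hsq₁ hsq₂)

/-- **SEMISTABLE CURVES HAVE IN-DEGREE ZERO**: if `N_W` is squarefree then `∀ U, ¬ TwoStepAt p U W` (every `p`, unconditionally) —
the far end of a certified two-step edge is never semistable. [cite: GrossLMS1991, §1 (p. 235)] -/
theorem not_twoStepAt_into_of_squarefree {W : WeierstrassCurve ℚ} (hN : Squarefree (W.conductorNorm ℤ))
    (p : ℕ) (U : WeierstrassCurve ℚ) : ¬ TwoStepAt p U W := fun h ↦ by
  obtain ⟨q₁, -, hq₁, -, -, -, -, hsq₁, -, -, -⟩ := TwoStepAt.exists_two_odd_primes_sq_dvd h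
  have hu : IsUnit q₁ := hN q₁ (by rw [← sq]; exact hsq₁)
  exact hq₁.one_lt.ne' (Nat.isUnit_iff.mp hu)

/-- **Class level, granted modularity** (`N_{W₁} = N_E` for `W₁ ∼ E`, Atkin–Lehner via `conductorNorm_eq_of_isIsogenous_of_modularity`):
if the odd primes with square dividing `N_E` form a subsingleton, no edge ends at any `W₁` isogenous to `E`.
[cite: AtkinLehner1970, Thm. 4] [cite: GrossLMS1991, §1 (p. 235)] -/
theorem not_twoStepAt_into_isogenous_of_sq_subsingleton (hmod : nonempty_modularParametrizationData)
    {E : WeierstrassCurve ℚ} [E.IsElliptic]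
    (h1 : ∀ q₁ q₂ : ℕ, q₁.Prime → q₂.Prime → q₁ ≠ 2 → q₂ ≠ 2 →
      q₁ ^ 2 ∣ E.conductorNorm ℤ → q₂ ^ 2 ∣ E.conductorNorm ℤ → q₁ = q₂)
    (W₁ : WeierstrassCurve ℚ) [W₁.IsElliptic] (hiso : IsIsogenous E W₁) (p : ℕ) (U : WeierstrassCurve ℚ) :
    ¬ TwoStepAt p U W₁ := by
  have hN : W₁.conductorNorm ℤ = E.conductorNorm ℤ := (conductorNorm_eq_of_isIsogenous_of_modularity hmod _ W₁ hiso).symm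
  exact not_twoStepAt_into_of_sq_subsingleton (by rw [hN]; exact h1) p U

/-- **Class level, granted modularity: a SEMISTABLE isogeny class has in-degree zero** — for every `W₁ ∼ E` with `N_E`
squarefree and every `U`, `p`: `¬ TwoStepAt p U W₁`. [cite: AtkinLehner1970, Thm. 4] [cite: GrossLMS1991, §1 (p. 235)] -/
theorem not_twoStepAt_into_isogenous_of_squarefree (hmod : nonempty_modularParametrizationData)
    {E : WeierstrassCurve ℚ} [E.IsElliptic] (hN : Squarefree (E.conductorNorm ℤ))
    (W₁ : WeierstrassCurve ℚ) [W₁.IsElliptic] (hiso : IsIsogenous E W₁) (p : ℕ) (U : WeierstrassCurve ℚ) :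
    ¬ TwoStepAt p U W₁ := by
  have hN₁ : W₁.conductorNorm ℤ = E.conductorNorm ℤ := (conductorNorm_eq_of_isIsogenous_of_modularity hmod _ W₁ hiso).symm
  exact not_twoStepAt_into_of_squarefree (by rw [hN₁]; exact hN) p U

/-! ## §4 What in-degree zero buys for the doors of 6⁷ (every `p`) -/

/-- **A zig-zag out of a vertex of in-degree zero is trivial or STARTS WITH A FORWARD EDGE** (`Relation.ReflTransGen.cases_head`; the
relation is 6⁷'s, token for token). Every `p` (gen 22's `…NoReverseEdge.eq_or_firstStep_forward_of_not_into` is the case `p = 13`).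
[folklore] -/
theorem eq_or_firstStep_forward_of_not_into {p : ℕ} [Fact p.Prime] {W₁ U : WeierstrassCurve ℚ}
    (hno : ∀ B : WeierstrassCurve ℚ, ¬ TwoStepAt p B W₁)
    (h : Relation.ReflTransGen (fun A B : WeierstrassCurve ℚ ↦ TwoStepAt p A B ∨
      (TwoStepAt p B A ∧ ∃ (_ : B.IsElliptic) (_ : B.IsGloballyMinimal), X2.CellB B p)) W₁ U) :
    U = W₁ ∨ ∃ B : WeierstrassCurve ℚ, TwoStepAt p W₁ B ∧
      Relation.ReflTransGen (fun A B : WeierstrassCurve ℚ ↦ TwoStepAt p A B ∨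
        (TwoStepAt p B A ∧ ∃ (_ : B.IsElliptic) (_ : B.IsGloballyMinimal), X2.CellB B p)) B U := by
  rcases h.cases_head with h0 | ⟨B, hWB, hBU⟩
  · exact Or.inl h0.symm
  · rcases hWB with hf | ⟨hr, -⟩
    · exact Or.inr ⟨B, hf, hBU⟩
    · exact absurd hr (hno B)

/-- **6⁷'s LEFT door at a SEMISTABLE class, granted modularity.** If `N_E` is squarefree, the left-disjunct datum of
`stub_offSubrow_connectedShaUnitOrPartner` at any `W ∼ E` (token for token: `W ∼ W₁ ⇝ W″ ∼ Wc`, `#Ш_an(Wc)` a rational `p`-unit) yields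
EITHER a globally minimal `Wc ∼ E` with `v_p(#Ш_an(Wc)) = 0` (distance `0` — there Wuthrich's Prop. 21 already gives the main
conjecture, `mazurMC_ofClassShaUnit`) OR a globally minimal `W₁ ∼ E` and a FORWARD edge `TwoStepAt p W₁ B` out of the class — whose
first datum is an imaginary quadratic `K`, Heegner for `N_{W₁}` and `p`, `d_K` odd `< −4`, with `r_an(W₁ ⊗ χ_{d_K}) = 1`. Nothing is
asserted about whether either datum exists. [cite: GrossLMS1991, §1 (p. 235)] [cite: Wuthrich2014, Prop. 21 (p. 400)] -/
theorem leftDoor_firstStep_of_squarefree {p : ℕ} [Fact p.Prime] (hmod : nonempty_modularParametrizationData)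
    {E : WeierstrassCurve ℚ} [E.IsElliptic] (hN : Squarefree (E.conductorNorm ℤ))
    (W : WeierstrassCurve ℚ) [W.IsElliptic] (hiso : IsIsogenous E W)
    (h0 : ∃ (W₁ : WeierstrassCurve ℚ) (_ : W₁.IsElliptic) (_ : W₁.IsGloballyMinimal)
      (W'' : WeierstrassCurve ℚ) (_ : W''.IsElliptic) (_ : W''.IsGloballyMinimal)
      (Wc : WeierstrassCurve ℚ) (_ : Wc.IsElliptic) (_ : Wc.IsGloballyMinimal),
      IsIsogenous W W₁ ∧
      Relation.ReflTransGen (fun A B : WeierstrassCurve ℚ ↦ TwoStepAt p A B ∨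
        (TwoStepAt p B A ∧ ∃ (_ : B.IsElliptic) (_ : B.IsGloballyMinimal), X2.CellB B p)) W₁ W'' ∧
      IsIsogenous W'' Wc ∧
      ∃ q : ℚ, shaAn Wc = (q : ℂ) ∧ padicValRat p q = 0) :
    (∃ (Wc : WeierstrassCurve ℚ) (_ : Wc.IsElliptic) (_ : Wc.IsGloballyMinimal), IsIsogenous E Wc ∧
        ∃ q : ℚ, shaAn Wc = (q : ℂ) ∧ padicValRat p q = 0) ∨
      (∃ (W₁ : WeierstrassCurve ℚ) (_ : W₁.IsElliptic) (_ : W₁.IsGloballyMinimal), IsIsogenous E W₁ ∧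
        (∃ B : WeierstrassCurve ℚ, TwoStepAt p W₁ B) ∧
        ∃ (K : Type) (_ : Field K) (_ : NumberField K), IsImaginaryQuadratic K ∧
          SatisfiesHeegnerHypothesis (W₁.conductorNorm ℤ) K ∧ SatisfiesHeegnerHypothesis p K ∧ Odd (NumberField.discr K) ∧
          NumberField.discr K < -4 ∧ (W₁.quadraticTwist (NumberField.discr K : ℚ)).analyticRank = 1) := by
  obtain ⟨W₁, iW₁, iW₁m, W'', iW'', iW''m, Wc, iWc, iWcm, hWW₁, hpath, hWWc, q, hq, hv⟩ := h0
  have hEW₁ : IsIsogenous E W₁ := hiso.trans' hWW₁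
  rcases eq_or_firstStep_forward_of_not_into (not_twoStepAt_into_isogenous_of_squarefree hmod hN W₁ hEW₁ p) hpath with
    hUW | ⟨B, hWB, -⟩
  · subst hUW
    exact Or.inl ⟨Wc, iWc, iWcm, hEW₁.trans' hWWc, q, hq, hv⟩
  · refine Or.inr ⟨W₁, iW₁, iW₁m, hEW₁, ⟨B, hWB⟩, ?_⟩
    obtain ⟨_, _, _, _, K, _, _, hK, hHN, hHp, hodd, hlt, hr1, -⟩ := hWB
    exact ⟨K, _, _, hK, hHN, hHp, hodd, hlt, hr1⟩

/-- **6⁷'s RIGHT door at a SEMISTABLE class, granted modularity.** If `N_E` is squarefree, the right-disjunct datum of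
`stub_offSubrow_connectedShaUnitOrPartner` at any `W ∼ E` (token for token: `W ∼ W₁ ⇝ U ∼ W₀` and a good partner AT `W₀` — an
admissible `K` with `r_an(W₀ ⊗ χ_{d_K}) = 1` and `MissingUpperBoundAt` at every globally minimal model of the twist) yields EITHER
such a partnered vertex `W₀ ∼ E` IN THE CLASS (distance `0`: the v4 «∃-PARTNER at the pair», consumed by the per-pair door
`…TwistbackOnePartnerAt`) OR a globally minimal `W₁ ∼ E` with a FORWARD edge `TwoStepAt p W₁ B` out of the class. Nothing is
asserted about whether either datum exists. [cite: GrossLMS1991, §1 (p. 235)] -/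
theorem rightDoor_firstStep_of_squarefree {p : ℕ} [Fact p.Prime] (hmod : nonempty_modularParametrizationData)
    {E : WeierstrassCurve ℚ} [E.IsElliptic] (hN : Squarefree (E.conductorNorm ℤ))
    (W : WeierstrassCurve ℚ) [W.IsElliptic] (hiso : IsIsogenous E W)
    (hV : ∃ (W₁ : WeierstrassCurve ℚ) (_ : W₁.IsElliptic) (_ : W₁.IsGloballyMinimal)
      (U : WeierstrassCurve ℚ) (_ : U.IsElliptic) (_ : U.IsGloballyMinimal)
      (W₀ : WeierstrassCurve ℚ) (_ : W₀.IsElliptic) (_ : W₀.IsGloballyMinimal),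
      IsIsogenous W W₁ ∧
      Relation.ReflTransGen (fun A B : WeierstrassCurve ℚ ↦ TwoStepAt p A B ∨
        (TwoStepAt p B A ∧ ∃ (_ : B.IsElliptic) (_ : B.IsGloballyMinimal), X2.CellB B p)) W₁ U ∧
      IsIsogenous U W₀ ∧
      ∃ (K : Type) (_ : Field K) (_ : NumberField K), IsImaginaryQuadratic K ∧
        SatisfiesHeegnerHypothesis (W₀.conductorNorm ℤ) K ∧ SatisfiesHeegnerHypothesis p K ∧
        Odd (NumberField.discr K) ∧ NumberField.discr K < -4 ∧
        (W₀.quadraticTwist (NumberField.discr K : ℚ)).analyticRank = 1 ∧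
        ∀ (Wd : WeierstrassCurve ℚ) [Wd.IsElliptic] [Wd.IsGloballyMinimal],
          (∃ C : VariableChange ℚ, C • Wd = W₀.quadraticTwist (NumberField.discr K : ℚ)) →
          MissingUpperBoundAt Wd p) :
    (∃ (W₀ : WeierstrassCurve ℚ) (_ : W₀.IsElliptic) (_ : W₀.IsGloballyMinimal), IsIsogenous E W₀ ∧
        ∃ (K : Type) (_ : Field K) (_ : NumberField K), IsImaginaryQuadratic K ∧
          SatisfiesHeegnerHypothesis (W₀.conductorNorm ℤ) K ∧ SatisfiesHeegnerHypothesis p K ∧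
          Odd (NumberField.discr K) ∧ NumberField.discr K < -4 ∧
          (W₀.quadraticTwist (NumberField.discr K : ℚ)).analyticRank = 1 ∧
          ∀ (Wd : WeierstrassCurve ℚ) [Wd.IsElliptic] [Wd.IsGloballyMinimal],
            (∃ C : VariableChange ℚ, C • Wd = W₀.quadraticTwist (NumberField.discr K : ℚ)) →
            MissingUpperBoundAt Wd p) ∨
      (∃ (W₁ : WeierstrassCurve ℚ) (_ : W₁.IsElliptic) (_ : W₁.IsGloballyMinimal), IsIsogenous E W₁ ∧
        ∃ B : WeierstrassCurve ℚ, TwoStepAt p W₁ B) := by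
  obtain ⟨W₁, iW₁, iW₁m, U, iU, iUm, W₀, iW₀, iW₀m, hWW₁, hpath, hUW₀, hK⟩ := hV
  have hEW₁ : IsIsogenous E W₁ := hiso.trans' hWW₁
  rcases eq_or_firstStep_forward_of_not_into (not_twoStepAt_into_isogenous_of_squarefree hmod hN W₁ hEW₁ p) hpath with
    hUW | ⟨B, hWB, -⟩
  · subst hUW
    exact Or.inl ⟨W₀, iW₀, iW₀m, hEW₁.trans' hUW₀, hK⟩
  · exact Or.inr ⟨W₁, iW₁, iW₁m, hEW₁, B, hWB⟩

end Summit.BirchSwinnertonDyer.BirchSwinnertonDyer.Theorems.EisensteinPrimesMazurMCOnCellBTwistbackReverseEdgeTwoFields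

end
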